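import Literature.Probability.Percolation.CoveringMonotonicity
import Literature.Barriers.CriticalPhenomena.SubexponentialGrowthZdProofs
import HarnessLib

/-!
# Growth can only increase upstairs along a weak covering: `|B_H(φ x, n)| ≤ |B_G(x, n)|`, and exponential growth of `H` forces exponential
# growth of `G` (graph level; unconditional)

builds on p205010 (kernel theorem, internal audit signed; external expert review pending) — nothing in this file uses p205010; pure graph theory, no node.
Lane `prim-bschramm`, seat `prim-bschramm-p4` gen 23 (PART C3 of `P4-GENERAL.md` §45.5).  Helper file (`--supports stmt-CriticalPhenomena-4575 --as helper`).

THE POINT.  A map `φ : V → W` sending the neighbourhood of every vertex of `G` ONTO the neighbourhood of its image in `H` (a weak covering in the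
sense of Lyons–Peres §6.9; e.g. every group homomorphism between Cayley graphs, `CayleyQuot.surjOn_neighborSet`, or the orbit map of a group of
automorphisms, tree `CoveringQuotientMap`) lifts walks step by step, so **`WeakCover.graphBall_subset_image`**: `B_H(φ x, n) ⊆ φ(B_G(x, n))`,
**`WeakCover.ballVolume_le`**: `|B_H(φ x, n)| ≤ |B_G(x, n)|`, and **`WeakCover.hasExponentialGrowth`**: exponential growth of `H` forces
exponential growth of `G`.  The Cayley-graph consequences (growth and `θ(p_c) = 0` inherited from a quotient group of exponential growth) are in
`CayleyQuotientGrowth`.  Def-free (proof lane).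
[cite: LyonsPeres2016, §6.9 (weak covering maps), Thm. 6.47] [cite: Hutchcroft2016, §1 (exponential growth)]
-/

noncomputable section

namespace Summit.CriticalPhenomena.PercolationContinuityZ3.Theorems.Transplant
open SimpleGraph Filter
open Literature.Barriers.CriticalPhenomena
open scoped Classical

/-! ## §1 Balls and growth along a weak covering -/

namespace WeakCover

variable {V W : Type*} (G : SimpleGraph V) (H : SimpleGraph W) (φ : V → W)

/-- **Path lifting**: along a neighbourhood-surjective map, every ball downstairs is the image of the ball upstairs:
`B_H(φ x, n) ⊆ φ(B_G(x, n))`. [cite: LyonsPeres2016, §6.9 (weak covering maps: lifting edges one at a time)] -/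
theorem graphBall_subset_image (hφ : ∀ x : V, Set.SurjOn φ (G.neighborSet x) (H.neighborSet (φ x))) (x : V) (n : ℕ) :
    graphBall H (φ x) n ⊆ φ '' graphBall G x n := by
  -- induct on a walk downstairs from `φ x`, generalising the base point
  suffices key : ∀ (a y : W) (w : H.Walk a y) (x : V), φ x = a → ∀ n, w.length ≤ n → y ∈ φ '' graphBall G x n by
    rintro y ⟨w, hw⟩
    exact key _ _ w x rfl n hw
  intro a y w
  induction w with
  | nil => intro x hx n _; exact ⟨x, mem_graphBall_self G x n, hx⟩
  | @cons a b c hab w ih =>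
    intro x hx n hn
    rw [Walk.length_cons] at hn
    obtain ⟨m, rfl⟩ : ∃ m, n = m + 1 := ⟨n - 1, by omega⟩
    have hb : b ∈ H.neighborSet (φ x) := by rw [mem_neighborSet, hx]; exact hab
    obtain ⟨z, hz, hzb⟩ := hφ x hb
    obtain ⟨y', hy', rfl⟩ := ih z hzb m (by omega)
    obtain ⟨w', hw'⟩ := hy'
    exact ⟨y', ⟨Walk.cons (G.mem_neighborSet x z |>.1 hz) w', by rw [Walk.length_cons]; omega⟩, rfl⟩

/-- **Ball volumes can only increase upstairs**: `|B_H(φ x, n)| ≤ |B_G(x, n)|` (`G` locally finite). [cite: LyonsPeres2016, §6.9, Thm. 6.47] -/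
theorem ballVolume_le [G.LocallyFinite] (hφ : ∀ x : V, Set.SurjOn φ (G.neighborSet x) (H.neighborSet (φ x))) (x : V) (n : ℕ) :
    ballVolume H (φ x) n ≤ ballVolume G x n := by
  unfold ballVolume
  exact (Set.ncard_le_ncard (graphBall_subset_image G H φ hφ x n) ((graphBall_finite G x n).image φ)).trans
    (Set.ncard_image_le (graphBall_finite G x n))

/-- **Exponential growth is inherited upstairs** along a neighbourhood-surjective map. [cite: LyonsPeres2016, §6.9; §7.4] [cite: Hutchcroft2016, §1] -/
theorem hasExponentialGrowth [G.LocallyFinite] (hφ : ∀ x : V, Set.SurjOn φ (G.neighborSet x) (H.neighborSet (φ x)))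
    (hH : HasExponentialGrowth H) : HasExponentialGrowth G := by
  intro x
  obtain ⟨c, hc, hev⟩ := hH (φ x)
  refine ⟨c, hc, hev.mono fun n hn => hn.trans ?_⟩
  exact_mod_cast ballVolume_le G H φ hφ x n

end WeakCover


end Summit.CriticalPhenomena.PercolationContinuityZ3.Theorems.Transplant
end
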